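import Summits.CriticalPhenomena.PercolationContinuityZ3.Theorems.PercNearOneGluingNoHeavyQuantSliceClosedAllLayers
import Summits.CriticalPhenomena.PercolationContinuityZ3.Theorems.PercNearOneGluingNoHeavyQuantLawDecStrongDuality
import HarnessLib

/-!
# QUANT lane R8, T-DEC: the SINGLE-LAYER DOMINATION property of slices (`LawDec.SliceDominated`, the structural form SL-window\* of the
# census) and the kernel reduction `SliceDominated → SliceClosedAll`

builds on p205010 (kernel theorem, internal audit signed; external expert review pending)

Statement + support file (`--supports stmt-CriticalPhenomena-4575`), QUANT lane seat prim-quant-census-2 (gen 54), rung R8 of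
`run/shared/lean/prim/quant/LADDER.md`.  Memo SL-STRUCTURE-G54 §2b.  One `@[conjecture]`, theorems with standard axioms, no sorries.  Uses
`…QuantLawDecStrongDuality` (g54: `decAtT_iff_prices`) and `…QuantSliceClosedAllLayers` (g54: `SliceClosedAll`).

THE PROPERTY (memo §2b, exact LP: the repaired counterexample family and 597 / 597 tight cells of the counterexample geometry, x38/x45/x47).  For the slice `slice μ a g` at its mean `T + ag` and
a layer `j′`, EVERY price system `(α, β)` of the slice (β ≥ 0, `α l ≤ usage·β h` on compatible pairs) is dominated COEFFICIENTWISE, as a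
functional of `μ`, by the price system `(α′, β′)` of `μ` at ONE layer `J ∈ [j′−a, j′]` (at the mean `T` of `μ`) plus a multiple `λ` of the mean
identity `Σ (k − T) μ k = 0`:  `(1−g)·e(k) + g·e(k+a) ≤ e′(k) + λ(k − T)` for every `k ≤ M`, where `e(p)` is `α p` on the slice's low positions
(`p ≤ j′`, `2p < T + ag`) and `−β p` elsewhere, and `e′(k)` is `α′ k` on the lows of layer `J` (`k ≤ J`, `2k < T`) and `−β′ k` elsewhere.
Weak duality at layer `J` (`dual_le_of_decAtT`) and the mean identity then give the weak-duality inequality for the slice, and STRONG duality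
(`decAtT_iff_prices`) turns that into DEC of the slice.

* **`LawDec.SliceDominated`** (`@[conjecture]`) — the property, for top-affordable laws DEC at every layer (same frame as `SliceClosedAll`).
* **`LawDec.sliceClosedAll_of_dominated : SliceDominated → SliceClosedAll`** — the reduction (the proof architecture of memo §2b in the kernel:
  a prover establishes SL-ALL by giving, for each certificate of the slice, the layer `J`, the prices `(α′, β′)` and the tilt `λ`).

[this work]; memos SL-STRUCTURE-G54, DEC-CLOSURE-G53 (this lane).  Farkas [cite: Schrijver1986, Cor 7.1f (p. 90)].  The gluing rows served
[cite: KozmaNitzan2024, Conjecture 3 (p. 15)]; product measure [cite: Grimmett1999, §1.3 p. 10].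
-/

noncomputable section

namespace Summit.CriticalPhenomena.PercolationContinuityZ3.Theorems

namespace Quant

open Finset

namespace LawDec

/-! ### Bookkeeping: a price functional of the slice is a functional of the law -/

/-- weighted shift: `Σ_{h < M+a+1} w h · (ν(h−a)·[a ≤ h]) = Σ_{k < M+1} w(k+a)·ν k`. [folklore] -/
theorem sum_weight_shift (ν w : ℕ → ℝ) (M a : ℕ) :
    ∑ h ∈ Finset.range (M + a + 1), w h * (if a ≤ h then ν (h - a) else 0)
      = ∑ k ∈ Finset.range (M + 1), w (k + a) * ν k := by
  rw [Finset.range_eq_Ico, ← Finset.sum_Ico_consecutive _ (Nat.zero_le a) (by omega : a ≤ M + a + 1)]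
  have hzero : ∑ h ∈ Finset.Ico 0 a, w h * (if a ≤ h then ν (h - a) else 0) = 0 := by
    refine Finset.sum_eq_zero fun h hh => ?_
    rw [Finset.mem_Ico] at hh
    rw [if_neg (by omega), mul_zero]
  rw [hzero, zero_add, Finset.sum_Ico_eq_sum_range, show M + a + 1 - a = M + 1 by omega, Finset.range_eq_Ico]
  refine Finset.sum_congr rfl fun k _ => ?_
  rw [if_pos (Nat.le_add_right a k), Nat.add_sub_cancel_left, add_comm]

/-- the signed coefficient of a price system `(α, β)` at a position `p` for target `S` and layer `J`: `α p` on lows, `−β p` elsewhere. [this work] -/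
def coefAt (S : ℝ) (J : ℕ) (α β : ℕ → ℝ) (p : ℕ) : ℝ :=
  if p ≤ J ∧ 2 * (p : ℝ) < S then α p else -β p

/-- **the weak-duality functional in coefficient form**: `Σ_{l ≤ J} [2l<S] α l ν l − Σ_{h ≤ N} [¬ low] β h ν h = Σ_{p ≤ N} coefAt p · ν p`
for a law `ν` vanishing above `N`, `J < N + 1`… stated with `J ≤ N`. [this work] -/
theorem dual_functional_eq (S : ℝ) (J N : ℕ) (α β ν : ℕ → ℝ) (hJN : J ≤ N) :
    ∑ l ∈ Finset.range (J + 1), (if 2 * (l : ℝ) < S then α l * ν l else 0)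
      - ∑ h ∈ Finset.range (N + 1), (if h ≤ J ∧ 2 * (h : ℝ) < S then 0 else β h * ν h)
      = ∑ p ∈ Finset.range (N + 1), coefAt S J α β p * ν p := by
  have e1 : ∑ l ∈ Finset.range (J + 1), (if 2 * (l : ℝ) < S then α l * ν l else 0)
      = ∑ p ∈ Finset.range (N + 1), (if p ≤ J ∧ 2 * (p : ℝ) < S then α p * ν p else 0) := by
    rw [← Finset.sum_range_add_sum_Ico _ (by omega : J + 1 ≤ N + 1)]
    have hz : ∑ p ∈ Finset.Ico (J + 1) (N + 1), (if p ≤ J ∧ 2 * (p : ℝ) < S then α p * ν p else 0) = 0 :=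
      Finset.sum_eq_zero fun p hp => by
        rw [Finset.mem_Ico] at hp
        rw [if_neg (fun h => by omega)]
    rw [hz, add_zero]
    refine Finset.sum_congr rfl fun p hp => ?_
    have hpJ : p ≤ J := Nat.lt_succ_iff.1 (Finset.mem_range.1 hp)
    by_cases h2 : 2 * (p : ℝ) < S
    · rw [if_pos h2, if_pos ⟨hpJ, h2⟩]
    · rw [if_neg h2, if_neg (fun h => h2 h.2)]
  rw [e1, ← Finset.sum_sub_distrib]
  refine Finset.sum_congr rfl fun p _ => ?_
  unfold coefAt
  split_ifs <;> ring

/-- **the slice's dual functional as a functional of the law**: for `μ` vanishing above `M` and `j′ < M + a`,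
`Σ_{p ≤ M+a} e(p)·slice μ a g p = Σ_{k ≤ M} ((1−g) e(k) + g e(k+a))·μ k`. [this work] -/
theorem slice_functional_eq (μ e : ℕ → ℝ) (M a : ℕ) (g : ℝ) (hμM : ∀ h, M < h → μ h = 0) :
    ∑ p ∈ Finset.range (M + a + 1), e p * slice μ a g p
      = ∑ k ∈ Finset.range (M + 1), ((1 - g) * e k + g * e (k + a)) * μ k := by
  simp only [slice]
  have esplit : ∀ p : ℕ, e p * ((1 - g) * μ p + g * (if a ≤ p then μ (p - a) else 0))
      = (1 - g) * (e p * μ p) + g * (e p * (if a ≤ p then μ (p - a) else 0)) := fun p => by ring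
  simp_rw [esplit]
  rw [Finset.sum_add_distrib, ← Finset.mul_sum, ← Finset.mul_sum, sum_weight_shift μ e M a,
    sum_range_extend (fun p => e p * μ p) M a (fun h hh => by simp only [hμM h hh, mul_zero])]
  rw [Finset.mul_sum, Finset.mul_sum, ← Finset.sum_add_distrib]
  refine Finset.sum_congr rfl fun k _ => ?_
  ring

/-! ### The domination property and the reduction -/

/-- **CONJECTURE SL-window\* (single-layer domination of slice certificates; census-2 g54, memo SL-STRUCTURE-G54 §2b).**  For a top-affordable
law `μ ≥ 0` on `{0..M}` (mass `1`, mean `T`) that is DEC at every layer, a blob `(a ≥ 1, x ≤ g < 1)`, a layer `j′ < M + a` and EVERY price system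
`(α, β)` of the slice at target `T + ag`, layer `j′` (`β ≥ 0`; `α l ≤ usage·β h` for `l ≤ j′`, `2l < T+ag`, `h ≤ M+a` compatible): there are a
layer `J` with `j′ − a ≤ J ≤ j′` and `J ≤ M`, a price system `(α′, β′)` of `μ` at target `T`, layer `J` (`β′ ≥ 0`, `α′ l ≤ usage·β′ h` on compatible pairs),
and a real `λ`, with `(1−g)·coefAt (T+ag) j′ α β k + g·coefAt (T+ag) j′ α β (k+a) ≤ coefAt T J α′ β′ k + λ·(k − T)` for every `k ≤ M`.
EVIDENCE: exact LP, 0 failures (repaired counterexample family: `J` = the band atom's position; 597 tight window cells; generic laws — there `λ < 0` alone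
suffices; the one law on which the component-wise route SDAT\* fails (kit j138928) is dominated by layer `j′−a` + λ); implies `SliceClosedAll`
(`sliceClosedAll_of_dominated`). [this work] [status: open] -/
@[conjecture] def SliceDominated : Prop :=
  ∀ (x g : ℝ) (M a j' : ℕ) (μ : ℕ → ℝ),
    0 < x → x ≤ g → g < 1 → 1 ≤ a →
    (∀ h, 0 ≤ μ h) → (∀ h, M < h → μ h = 0) → (∑ h ∈ Finset.range (M + 1), μ h = 1) →
    (∀ h, 0 < μ h → x * (h : ℝ) ≤ ∑ k ∈ Finset.range (M + 1), (k : ℝ) * μ k) →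
    j' < M + a →
    (∀ i, DECAt x i M μ) →
    ∀ (α β : ℕ → ℝ), (∀ h, 0 ≤ β h) →
      (∀ l h, l ≤ j' → 2 * (l : ℝ) < (∑ k ∈ Finset.range (M + 1), (k : ℝ) * μ k) + (a : ℝ) * g → h ≤ M + a →
        (j' + 1 ≤ h ∨ (∑ k ∈ Finset.range (M + 1), (k : ℝ) * μ k) + (a : ℝ) * g < (l : ℝ) + h) →
        α l ≤ usage x ((∑ k ∈ Finset.range (M + 1), (k : ℝ) * μ k) + (a : ℝ) * g) j' l h * β h) →
      ∃ (J : ℕ) (α' β' : ℕ → ℝ) (lam : ℝ), j' - a ≤ J ∧ J ≤ j' ∧ J ≤ M ∧ (∀ h, 0 ≤ β' h) ∧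
        (∀ l h, l ≤ J → 2 * (l : ℝ) < (∑ k ∈ Finset.range (M + 1), (k : ℝ) * μ k) → h ≤ M →
          (J + 1 ≤ h ∨ (∑ k ∈ Finset.range (M + 1), (k : ℝ) * μ k) < (l : ℝ) + h) →
          α' l ≤ usage x (∑ k ∈ Finset.range (M + 1), (k : ℝ) * μ k) J l h * β' h) ∧
        (∀ k, k ≤ M →
          (1 - g) * coefAt ((∑ q ∈ Finset.range (M + 1), (q : ℝ) * μ q) + (a : ℝ) * g) j' α β k
            + g * coefAt ((∑ q ∈ Finset.range (M + 1), (q : ℝ) * μ q) + (a : ℝ) * g) j' α β (k + a)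
          ≤ coefAt (∑ q ∈ Finset.range (M + 1), (q : ℝ) * μ q) J α' β' k
            + lam * ((k : ℝ) - ∑ q ∈ Finset.range (M + 1), (q : ℝ) * μ q))

/-- **SINGLE-LAYER DOMINATION ⟹ SL-ALL.**  Weak duality at the dominating layer `J` (`dual_le_of_decAtT`), the mean identity, and strong duality
for the slice (`decAtT_iff_prices`). [this work] -/
theorem sliceClosedAll_of_dominated (hD : SliceDominated) : SliceClosedAll := by
  intro x g M a j' μ hx0 hxg hg1 ha hμ0 hμM hμ1 htop hjM hdec
  have hx1 : x < 1 := lt_of_le_of_lt hxg hg1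
  set T : ℝ := ∑ k ∈ Finset.range (M + 1), (k : ℝ) * μ k with hT
  -- law facts of the slice
  have hsM : ∀ h, M + a < h → slice μ a g h = 0 := fun h hh => slice_eq_zero μ a g M hμM h hh
  have hs1 := sum_slice μ a g M hμM hμ1
  have hsmean : ∑ h ∈ Finset.range (M + a + 1), (h : ℝ) * slice μ a g h = T + (a : ℝ) * g := by
    rw [sum_mul_slice μ a g M hμM hμ1]
  rw [decAt_iff_decAtT, hsmean, decAtT_iff_prices x (T + (a : ℝ) * g) j' (M + a) (slice μ a g) hx0 hx1 hsM hs1]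
  intro α β hβ hαβ
  obtain ⟨J, α', β', lam, hJ1, hJ2, hJM, hβ', hαβ', hdom⟩ := hD x g M a j' μ hx0 hxg hg1 ha hμ0 hμM hμ1 htop hjM hdec α β hβ hαβ
  -- weak duality at layer J
  have hdecJ : DECAtT x T J M μ := (decAt_iff_decAtT x J M μ).1 (hdec J)
  have wd := dual_le_of_decAtT x T J M μ hx0 hx1 hdecJ α' β' hβ' hαβ'
  -- the mean identity: Σ (k − T) μ k = 0
  have hmeanid : ∑ k ∈ Finset.range (M + 1), ((k : ℝ) - T) * μ k = 0 := by
    have : ∑ k ∈ Finset.range (M + 1), ((k : ℝ) - T) * μ k = ∑ k ∈ Finset.range (M + 1), (k : ℝ) * μ k - T * ∑ k ∈ Finset.range (M + 1), μ k := by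
      rw [Finset.mul_sum, ← Finset.sum_sub_distrib]
      refine Finset.sum_congr rfl fun k _ => by ring
    rw [this, hμ1, mul_one, hT, sub_self]
  -- rewrite the goal as `Σ_p coefAt · slice ≤ 0`, then as a functional of μ
  have hjMa : j' ≤ M + a := hjM.le
  have goal_eq := dual_functional_eq (T + (a : ℝ) * g) j' (M + a) α β (slice μ a g) hjMa
  rw [slice_functional_eq μ (coefAt (T + (a : ℝ) * g) j' α β) M a g hμM] at goal_eq
  -- the layer-J functional in coefficient form
  have wd_eq := dual_functional_eq T J M α' β' μ hJM
  -- combine: Σ_k [(1−g)e(k) + g e(k+a)] μ k ≤ Σ_k [e′(k) + λ(k−T)] μ k = (layer-J functional) + λ·0 ≤ 0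
  have hle : ∑ k ∈ Finset.range (M + 1), ((1 - g) * coefAt (T + (a : ℝ) * g) j' α β k + g * coefAt (T + (a : ℝ) * g) j' α β (k + a)) * μ k
      ≤ ∑ k ∈ Finset.range (M + 1), (coefAt T J α' β' k + lam * ((k : ℝ) - T)) * μ k := by
    refine Finset.sum_le_sum fun k hk => ?_
    exact mul_le_mul_of_nonneg_right (hdom k (Nat.lt_succ_iff.1 (Finset.mem_range.1 hk))) (hμ0 k)
  have hsplit : ∑ k ∈ Finset.range (M + 1), (coefAt T J α' β' k + lam * ((k : ℝ) - T)) * μ k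
      = ∑ k ∈ Finset.range (M + 1), coefAt T J α' β' k * μ k + lam * ∑ k ∈ Finset.range (M + 1), ((k : ℝ) - T) * μ k := by
    rw [Finset.mul_sum, ← Finset.sum_add_distrib]
    refine Finset.sum_congr rfl fun k _ => by ring
  rw [hsplit, hmeanid, mul_zero, add_zero, ← wd_eq] at hle
  have : ∑ l ∈ Finset.range (J + 1), (if 2 * (l : ℝ) < T then α' l * μ l else 0)
      - ∑ h ∈ Finset.range (M + 1), (if h ≤ J ∧ 2 * (h : ℝ) < T then 0 else β' h * μ h) ≤ 0 := by linarith
  linarith [goal_eq ▸ (le_trans (le_of_eq rfl) hle)]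

end LawDec

end Quant

end Summit.CriticalPhenomena.PercolationContinuityZ3.Theorems
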